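import Literature.LinearAlgebra.Matrix.AdjoinSingletonSimpleFactors
import Literature.LinearAlgebra.Matrix.NonderogatoryCommutant
import Mathlib.GroupTheory.Index
import HarnessLib

/-!
# The centraliser torus of a regular semisimple element of `GL_N(K)`: `Z(A) = K[A]ˣ`, `Z(t) = Z(A)` for regular `t ∈ Z(A)`,
# and (for `N = 2`) the Weyl group `N(Z(A)) ∕ Z(A)` has at most two elements
(Horn–Johnson (2013) Thm. 3.2.4.2 ∕ 3.3.15; Harish-Chandra (1970) Lemma 42: `W_A = Ã ∕ A` is finite)

Topic `LinearAlgebra/Matrix`; namespace `Literature.LinearAlgebra.Matrix`.  Theorems only (no definition, no named fact, no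
instance, no `sorry`); Mathlib + ★ `NonderogatoryCommutant` (the commutant of a nonderogatory matrix is `K[A]`) + ★
`NonderogatoryCommutantBaseChange` (`minpoly = charpoly` for separable `charpoly`) + ★ `AdjoinSingletonSimpleFactors`
(`dim_K K[A] = N`).

THE RESULTS (all PROVED; `K` a field, `A ∈ GL_N(K)` with SEPARABLE characteristic polynomial = regular semisimple).
* `mem_centralizer_gl_iff_mem_adjoin` — **`g ∈ Z_{GL_N(K)}(A) ⟺ g ∈ K[A]`** (as a matrix); `centralizer_gl_comm` — `Z(A)` is
  commutative (the torus axiom (ab)).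
* `centralizer_gl_eq_of_mem` — **`Z(t) = Z(A)` for every regular semisimple `t ∈ Z(A)`** (`K[t] ⊆ K[A]`, both of dimension
  `N`) (the torus axiom (zz)).
* `conj_mem_centralizer_of_mem_normalizer`, `charpoly_gl_conj` — bookkeeping.
* `N = 2`, `char K ≠ 2`: `trace_sq_sub_four_det_ne_zero_of_separable` (`disc ≠ 0`), `eq_or_eq_of_mem_adjoin_of_charpoly_eq` —
  **the only elements of `K[A]` with the characteristic polynomial of `A` are `A` and `tr(A)·1 − A`** (the two roots of `p_A`
  in `K[A]`), hence **`index_centralizer_subgroupOf_normalizer_ne_zero`**: `N(Z(A)) ∕ Z(A)` is finite (it injects into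
  `{A, tr(A)·1 − A}` by `n ↦ n A n⁻¹`) — the torus axiom (w), `|W| ≤ 2`.

WHY (the use).  These are the field-level torus axioms (ab), (zz), (w) of ★
`Literature.NumberTheory.Automorphic.WeylVanishingCanonical.integral_eq_zero_of_forall_classOrbitalIntegral_eq_zero` for
`G = GL₂(F) × GL₁(F) ≅ H_v` (split place), to be transported along ★ `localSplitEquiv` (road «W1s soft Weyl» of the P3b line
«CMCharIdentityTest», stub `stub_weylVanishingSplit`).

## References
* [HornJohnson2013] R. A. Horn, C. R. Johnson, *Matrix Analysis*, 2nd ed. (2013), Thm. 3.2.4.2 (p. 236), Thm. 3.3.15 (p. 257).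
* [HarishChandra1970] Harish-Chandra, *Harmonic analysis on reductive p-adic groups*, LNM 162 (1970), Lemma 42 (`W_A = Ã∕A`).
-/

set_option autoImplicit false

noncomputable section

open Polynomial
open scoped Matrix

namespace Literature.LinearAlgebra.Matrix

section General

variable {K : Type} [Field K] {N : ℕ}

/-- Two polynomials in the same matrix commute. [cite: HornJohnson2013, Thm 3.2.4.2, p0236] -/
theorem aeval_mul_aeval_comm (A : Matrix (Fin N) (Fin N) K) (p q : K[X]) : aeval A p * aeval A q = aeval A q * aeval A p := by
  rw [← map_mul, ← map_mul, mul_comm]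

/-- **`Z_{GL_N(K)}(A) = K[A]ˣ` for `A` regular semisimple**: an invertible matrix commutes with `A` iff it lies in the subalgebra
`K[A]` (★ `exists_eq_aeval_of_commute_of_minpoly_eq_charpoly`, `q_A = p_A` by ★ `minpoly_eq_charpoly_of_charpoly_separable`).
[cite: HornJohnson2013, Thm 3.2.4.2, p0236] -/
theorem mem_centralizer_gl_iff_mem_adjoin (A : GL (Fin N) K) (hA : (A : Matrix (Fin N) (Fin N) K).charpoly.Separable)
    (g : GL (Fin N) K) :
    g ∈ Subgroup.centralizer ({A} : Set (GL (Fin N) K)) ↔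
      (g : Matrix (Fin N) (Fin N) K) ∈ Algebra.adjoin K ({(A : Matrix (Fin N) (Fin N) K)} : Set (Matrix (Fin N) (Fin N) K)) := by
  rw [Subgroup.mem_centralizer_singleton_iff]
  constructor
  · intro h
    have h1 : (g : Matrix (Fin N) (Fin N) K) * A = A * g := by
      simpa only [Units.val_mul] using congrArg (fun u : GL (Fin N) K => (u : Matrix (Fin N) (Fin N) K)) h
    have hc : Commute (A : Matrix (Fin N) (Fin N) K) (g : Matrix (Fin N) (Fin N) K) := h1.symm
    obtain ⟨p, -, hp⟩ := exists_eq_aeval_of_commute_of_minpoly_eq_charpoly (A : Matrix (Fin N) (Fin N) K) g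
      (minpoly_eq_charpoly_of_charpoly_separable _ hA) hc
    rw [hp]
    exact Polynomial.aeval_mem_adjoin_singleton K _
  · intro h
    rw [Algebra.adjoin_singleton_eq_range_aeval] at h
    obtain ⟨p, hp⟩ := h
    apply Units.ext
    rw [Units.val_mul, Units.val_mul, ← hp]
    have hX : aeval (A : Matrix (Fin N) (Fin N) K) (X : K[X]) = (A : Matrix (Fin N) (Fin N) K) := aeval_X _
    calc aeval (A : Matrix (Fin N) (Fin N) K) p * (A : Matrix (Fin N) (Fin N) K)
        = aeval (A : Matrix (Fin N) (Fin N) K) p * aeval (A : Matrix (Fin N) (Fin N) K) (X : K[X]) := by rw [hX]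
      _ = aeval (A : Matrix (Fin N) (Fin N) K) (X : K[X]) * aeval (A : Matrix (Fin N) (Fin N) K) p :=
          aeval_mul_aeval_comm _ _ _
      _ = (A : Matrix (Fin N) (Fin N) K) * aeval (A : Matrix (Fin N) (Fin N) K) p := by rw [hX]

/-- **The centraliser of a regular semisimple element of `GL_N(K)` is commutative** (it is `K[A]ˣ`).
[cite: HornJohnson2013, 3.2.P1, p0247] -/
theorem centralizer_gl_comm (A : GL (Fin N) K) (hA : (A : Matrix (Fin N) (Fin N) K).charpoly.Separable) :
    ∀ a ∈ Subgroup.centralizer ({A} : Set (GL (Fin N) K)), ∀ b ∈ Subgroup.centralizer ({A} : Set (GL (Fin N) K)),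
      a * b = b * a := by
  intro a ha b hb
  rw [mem_centralizer_gl_iff_mem_adjoin A hA, Algebra.adjoin_singleton_eq_range_aeval] at ha hb
  obtain ⟨p, hp⟩ := ha
  obtain ⟨q, hq⟩ := hb
  apply Units.ext
  rw [Units.val_mul, Units.val_mul, ← hp, ← hq]
  exact aeval_mul_aeval_comm _ _ _

/-- **`Z(t) = Z(A)` for every regular semisimple `t ∈ Z(A)`** (`A` regular semisimple): `t ∈ K[A]` gives `K[t] ⊆ K[A]`, and
both have dimension `N` (★ `finrank_adjoin_singleton_eq_of_charpoly_separable`), so `K[t] = K[A]` and the two unit groups inside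
`GL_N(K)` agree. [cite: HornJohnson2013, Thm 3.3.15, p0257] -/
theorem centralizer_gl_eq_of_mem (A : GL (Fin N) K) (hA : (A : Matrix (Fin N) (Fin N) K).charpoly.Separable)
    {t : GL (Fin N) K} (ht : t ∈ Subgroup.centralizer ({A} : Set (GL (Fin N) K)))
    (htr : (t : Matrix (Fin N) (Fin N) K).charpoly.Separable) :
    Subgroup.centralizer ({t} : Set (GL (Fin N) K)) = Subgroup.centralizer ({A} : Set (GL (Fin N) K)) := by
  have htA : (t : Matrix (Fin N) (Fin N) K) ∈ Algebra.adjoin K ({(A : Matrix (Fin N) (Fin N) K)} : Set (Matrix (Fin N) (Fin N) K)) :=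
    (mem_centralizer_gl_iff_mem_adjoin A hA t).1 ht
  have hle : Algebra.adjoin K ({(t : Matrix (Fin N) (Fin N) K)} : Set (Matrix (Fin N) (Fin N) K)) ≤
      Algebra.adjoin K ({(A : Matrix (Fin N) (Fin N) K)} : Set (Matrix (Fin N) (Fin N) K)) :=
    Algebra.adjoin_le (Set.singleton_subset_iff.2 htA)
  haveI : FiniteDimensional K ↥(Algebra.adjoin K ({(A : Matrix (Fin N) (Fin N) K)} : Set (Matrix (Fin N) (Fin N) K))) :=
    FiniteDimensional.finiteDimensional_submodule
      (Subalgebra.toSubmodule (Algebra.adjoin K ({(A : Matrix (Fin N) (Fin N) K)} : Set (Matrix (Fin N) (Fin N) K))))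
  have heq : Algebra.adjoin K ({(t : Matrix (Fin N) (Fin N) K)} : Set (Matrix (Fin N) (Fin N) K)) =
      Algebra.adjoin K ({(A : Matrix (Fin N) (Fin N) K)} : Set (Matrix (Fin N) (Fin N) K)) :=
    Subalgebra.eq_of_le_of_finrank_eq hle (by
      rw [finrank_adjoin_singleton_eq_of_charpoly_separable _ htr, finrank_adjoin_singleton_eq_of_charpoly_separable _ hA])
  ext g
  rw [mem_centralizer_gl_iff_mem_adjoin t htr, mem_centralizer_gl_iff_mem_adjoin A hA, heq]

/-- An element of the normaliser of `Z(A)` conjugates `A` into `Z(A)`. [cite: HarishChandra1970, Lemma 42] -/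
theorem conj_mem_centralizer_of_mem_normalizer {G : Type*} [Group G] (A : G) {n : G}
    (hn : n ∈ Subgroup.normalizer ((Subgroup.centralizer ({A} : Set G) : Subgroup G) : Set G)) :
    n * A * n⁻¹ ∈ Subgroup.centralizer ({A} : Set G) :=
  (Subgroup.mem_normalizer_iff.1 hn A).1 (Subgroup.mem_centralizer_singleton_iff.2 rfl)

/-- Conjugate invertible matrices have the same characteristic polynomial. [cite: HornJohnson2013, Thm 1.3.3, p0058] -/
theorem charpoly_gl_conj (n A : GL (Fin N) K) :
    ((n * A * n⁻¹ : GL (Fin N) K) : Matrix (Fin N) (Fin N) K).charpoly = (A : Matrix (Fin N) (Fin N) K).charpoly := by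
  rw [Units.val_mul, Units.val_mul, Matrix.coe_units_inv]
  exact _root_.Matrix.charpoly_units_conj n (A : Matrix (Fin N) (Fin N) K)

end General

/-! ### `N = 2`: the Weyl group of a regular torus of `GL₂(K)` has at most two elements -/

section Two

variable {K : Type} [Field K] [NeZero (2 : K)]

/-- A separable monic quadratic has non-zero discriminant: for `A ∈ M₂(K)` with `p_A = X² − tr(A) X + det(A)` separable,
`tr(A)² − 4 det(A) ≠ 0` (otherwise `p_A = (X − tr(A)/2)²` is not squarefree; `char K ≠ 2`). [cite: HornJohnson2013, Thm 1.3.3, p0058] -/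
theorem trace_sq_sub_four_det_ne_zero_of_separable (A : Matrix (Fin 2) (Fin 2) K) (hA : A.charpoly.Separable) :
    A.trace ^ 2 - 4 * A.det ≠ 0 := by
  intro h0
  have h2 : (2 : K) ≠ 0 := NeZero.ne 2
  set c : K := A.trace / 2 with hc
  have htc : A.trace = 2 * c := by rw [hc]; field_simp
  have hdc : A.det = c ^ 2 := by
    have h4 : 4 * A.det = A.trace ^ 2 := by linear_combination -h0
    rw [htc] at h4
    have h4' : (4 : K) * A.det = 4 * c ^ 2 := by linear_combination h4
    have h4ne : (4 : K) ≠ 0 := by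
      have : (4 : K) = 2 * 2 := by norm_num
      rw [this]; exact mul_ne_zero h2 h2
    exact mul_left_cancel₀ h4ne h4'
  -- `p_A = (X − c)²`
  have hsq : A.charpoly = (X - C c) ^ 2 := by
    rw [Matrix.charpoly_fin_two]
    have ht : C A.trace = 2 * C c := by rw [htc, map_mul, map_ofNat]
    have hd : C A.det = C c ^ 2 := by rw [hdc, map_pow]
    linear_combination (-X) * ht + hd
  have hsf := hA.squarefree
  rw [hsq, pow_two] at hsf
  exact Polynomial.not_isUnit_X_sub_C c (hsf _ (dvd_refl _))

/-- **The roots of `p_A` in `K[A]` are `A` and `tr(A)·1 − A`** (`A ∈ M₂(K)` with separable `p_A`, `char K ≠ 2`): if `B ∈ K[A]`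
has `tr B = tr A` and `det B = det A` then `B = A` or `B = tr(A)·1 − A`.  (Write `B = x·1 + y·A`; the two trace ∕ determinant
equations give `(1 − y²)(tr² − 4 det) = 0`.) [cite: HornJohnson2013, Thm 3.2.4.2, p0236] -/
theorem eq_or_eq_of_mem_adjoin_of_trace_eq_of_det_eq (A : Matrix (Fin 2) (Fin 2) K) (hA : A.charpoly.Separable)
    {B : Matrix (Fin 2) (Fin 2) K} (hB : B ∈ Algebra.adjoin K ({A} : Set (Matrix (Fin 2) (Fin 2) K)))
    (htr : B.trace = A.trace) (hdet : B.det = A.det) :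
    B = A ∨ B = A.trace • (1 : Matrix (Fin 2) (Fin 2) K) - A := by
  have h2 : (2 : K) ≠ 0 := NeZero.ne 2
  have hdisc := trace_sq_sub_four_det_ne_zero_of_separable A hA
  -- `B = x • 1 + y • A` with `deg < 2`
  have hcomm : Commute A B := by
    rw [Algebra.adjoin_singleton_eq_range_aeval] at hB
    obtain ⟨p, rfl⟩ := hB
    have hX : aeval A (X : K[X]) = A := aeval_X _
    change A * aeval A p = aeval A p * A
    calc A * aeval A p = aeval A (X : K[X]) * aeval A p := by rw [hX]
      _ = aeval A p * aeval A (X : K[X]) := aeval_mul_aeval_comm A _ _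
      _ = aeval A p * A := by rw [hX]
  obtain ⟨p, hpdeg, hp⟩ := exists_eq_aeval_of_commute_of_minpoly_eq_charpoly A B
    (minpoly_eq_charpoly_of_charpoly_separable _ hA) hcomm
  have hcard : (Fintype.card (Fin 2) : ℕ) = 2 := Fintype.card_fin 2
  rw [hcard] at hpdeg
  have hdeg1 : p.degree ≤ 1 := by
    rw [Polynomial.degree_le_iff_coeff_zero]
    intro m hm
    have hm' : 1 < m := by exact_mod_cast hm
    exact (Polynomial.degree_lt_iff_coeff_zero p 2).1 hpdeg m hm'
  have hp2 : p = C (p.coeff 0) + C (p.coeff 1) * X :=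
    (Polynomial.eq_X_add_C_of_degree_le_one hdeg1).trans (by ring)
  set x := p.coeff 0 with hx
  set y := p.coeff 1 with hy
  have hBxy : B = x • (1 : Matrix (Fin 2) (Fin 2) K) + y • A := by
    rw [hp, hp2]
    simp only [map_add, map_mul, aeval_C, aeval_X, Algebra.algebraMap_eq_smul_one, smul_mul_assoc, one_mul]
  -- trace and determinant in the coordinates `(x, y)`
  set t := A.trace with htdef
  set d := A.det with hddef
  have htrB : B.trace = 2 * x + y * t := by
    rw [hBxy, Matrix.trace_add, Matrix.trace_smul, Matrix.trace_smul, Matrix.trace_one, smul_eq_mul, smul_eq_mul,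
      Fintype.card_fin]
    push_cast
    ring
  have hdetB : B.det = x ^ 2 + x * y * t + y ^ 2 * d := by
    rw [hBxy, Matrix.det_fin_two, htdef, hddef, Matrix.trace_fin_two, Matrix.det_fin_two]
    simp only [Matrix.add_apply, Matrix.smul_apply, Matrix.one_apply_eq, Matrix.one_apply_ne (by decide : (0 : Fin 2) ≠ 1),
      Matrix.one_apply_ne (by decide : (1 : Fin 2) ≠ 0), smul_eq_mul, mul_one, mul_zero, zero_add]
    ring
  rw [htrB] at htr
  rw [hdetB] at hdet
  -- `(1 − y²)(t² − 4d) = 0`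
  have hkey : (1 - y ^ 2) * (t ^ 2 - 4 * d) = 0 := by
    have hx2 : 2 * x = t * (1 - y) := by linear_combination htr
    linear_combination 4 * hdet - (2 * x + t + t * y) * hx2
  have hy2 : y ^ 2 = 1 := by
    have := mul_eq_zero.1 hkey
    rcases this with h | h
    · linear_combination -h
    · exact absurd h hdisc
  have hy : y = 1 ∨ y = -1 := by
    have : (y - 1) * (y + 1) = 0 := by linear_combination hy2
    rcases mul_eq_zero.1 this with h | h
    · left; linear_combination h
    · right; linear_combination h
  rcases hy with hy1 | hy1
  · -- `y = 1`, `x = 0`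
    left
    have hx0 : x = 0 := by
      have : 2 * x = 0 := by rw [hy1] at htr; linear_combination htr
      rcases mul_eq_zero.1 this with h | h
      · exact absurd h h2
      · exact h
    rw [hBxy, hx0, hy1, zero_smul, one_smul, zero_add]
  · -- `y = −1`, `x = t`
    right
    have hxt : x = t := by
      have : 2 * x = 2 * t := by rw [hy1] at htr; linear_combination htr
      have := mul_left_cancel₀ h2 this
      exact this
    rw [hBxy, hxt, hy1, neg_one_smul, ← sub_eq_add_neg]

/-- **The Weyl group of a regular torus of `GL₂(K)` is finite (of order `≤ 2`)**: for `A ∈ GL₂(K)` with separable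
characteristic polynomial and `T = Z(A)`, the index of `T` in its normaliser is non-zero — `n ↦ n A n⁻¹` sends `N(T)`
into `{A, tr(A)·1 − A}` with fibres the cosets of `T`. (`char K ≠ 2`.) [cite: HarishChandra1970, Lemma 42]
[cite: HornJohnson2013, Thm 3.2.4.2, p0236] -/
theorem index_centralizer_subgroupOf_normalizer_ne_zero (A : GL (Fin 2) K)
    (hA : (A : Matrix (Fin 2) (Fin 2) K).charpoly.Separable) :
    ((Subgroup.centralizer ({A} : Set (GL (Fin 2) K))).subgroupOf
      (Subgroup.normalizer ((Subgroup.centralizer ({A} : Set (GL (Fin 2) K)) : Subgroup (GL (Fin 2) K)) :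
        Set (GL (Fin 2) K)))).index ≠ 0 := by
  classical
  set T : Subgroup (GL (Fin 2) K) := Subgroup.centralizer ({A} : Set (GL (Fin 2) K)) with hT
  set Nm : Subgroup (GL (Fin 2) K) := Subgroup.normalizer (T : Set (GL (Fin 2) K)) with hNm
  -- `F n := n A n⁻¹` (as a matrix)
  let F : Nm → Matrix (Fin 2) (Fin 2) K := fun n => (((n : GL (Fin 2) K) * A * (n : GL (Fin 2) K)⁻¹ : GL (Fin 2) K) :
    Matrix (Fin 2) (Fin 2) K)
  -- its range lies in the two-element set `{A, tr A • 1 − A}`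
  have hrange : Set.range F ⊆ {(A : Matrix (Fin 2) (Fin 2) K),
      (A : Matrix (Fin 2) (Fin 2) K).trace • (1 : Matrix (Fin 2) (Fin 2) K) - (A : Matrix (Fin 2) (Fin 2) K)} := by
    rintro _ ⟨n, rfl⟩
    have hmem : (n : GL (Fin 2) K) * A * (n : GL (Fin 2) K)⁻¹ ∈ T := conj_mem_centralizer_of_mem_normalizer A n.2
    have hadj := (mem_centralizer_gl_iff_mem_adjoin A hA _).1 hmem
    have hchar := charpoly_gl_conj (n : GL (Fin 2) K) A
    have htr : (((n : GL (Fin 2) K) * A * (n : GL (Fin 2) K)⁻¹ : GL (Fin 2) K) : Matrix (Fin 2) (Fin 2) K).trace =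
        (A : Matrix (Fin 2) (Fin 2) K).trace := by
      rw [Matrix.trace_eq_neg_charpoly_coeff, Matrix.trace_eq_neg_charpoly_coeff, hchar]
    have hdet : (((n : GL (Fin 2) K) * A * (n : GL (Fin 2) K)⁻¹ : GL (Fin 2) K) : Matrix (Fin 2) (Fin 2) K).det =
        (A : Matrix (Fin 2) (Fin 2) K).det := by
      rw [Matrix.det_eq_sign_charpoly_coeff, Matrix.det_eq_sign_charpoly_coeff, hchar]
    rcases eq_or_eq_of_mem_adjoin_of_trace_eq_of_det_eq (A : Matrix (Fin 2) (Fin 2) K) hA hadj htr hdet with h | h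
    · exact Or.inl h
    · exact Or.inr h
  have hfin : (Set.range F).Finite := (Set.toFinite _).subset hrange
  -- the kernel of `F` is the coset relation of `T ∩ N` in `N`
  have hker : Setoid.ker F = QuotientGroup.leftRel (T.subgroupOf Nm) := by
    ext n n'
    rw [Setoid.ker_def, QuotientGroup.leftRel_apply, Subgroup.mem_subgroupOf, hT, Subgroup.mem_centralizer_singleton_iff]
    constructor
    · intro h
      have h' : (n : GL (Fin 2) K) * A * (n : GL (Fin 2) K)⁻¹ = (n' : GL (Fin 2) K) * A * (n' : GL (Fin 2) K)⁻¹ := Units.ext h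
      change ((n⁻¹ * n' : Nm) : GL (Fin 2) K) * A = A * ((n⁻¹ * n' : Nm) : GL (Fin 2) K)
      rw [Subgroup.coe_mul, Subgroup.coe_inv]
      calc ((n : GL (Fin 2) K))⁻¹ * (n' : GL (Fin 2) K) * A
          = (n : GL (Fin 2) K)⁻¹ * ((n' : GL (Fin 2) K) * A * (n' : GL (Fin 2) K)⁻¹) * (n' : GL (Fin 2) K) := by group
        _ = (n : GL (Fin 2) K)⁻¹ * ((n : GL (Fin 2) K) * A * (n : GL (Fin 2) K)⁻¹) * (n' : GL (Fin 2) K) := by rw [← h']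
        _ = A * ((↑n)⁻¹ * ↑n') := by group
    · intro h
      change ((n⁻¹ * n' : Nm) : GL (Fin 2) K) * A = A * ((n⁻¹ * n' : Nm) : GL (Fin 2) K) at h
      rw [Subgroup.coe_mul, Subgroup.coe_inv] at h
      apply congrArg (fun u : GL (Fin 2) K => (u : Matrix (Fin 2) (Fin 2) K))
      symm
      calc (n' : GL (Fin 2) K) * A * (n' : GL (Fin 2) K)⁻¹
          = (n : GL (Fin 2) K) * ((↑n)⁻¹ * ↑n' * A) * (n' : GL (Fin 2) K)⁻¹ := by group
        _ = (n : GL (Fin 2) K) * (A * ((↑n)⁻¹ * ↑n')) * (n' : GL (Fin 2) K)⁻¹ := by rw [h]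
        _ = (n : GL (Fin 2) K) * A * (n : GL (Fin 2) K)⁻¹ := by group
  haveI : Finite (Quotient (Setoid.ker F)) := by
    haveI : Finite ↥(Set.range F) := hfin.to_subtype
    exact Finite.of_equiv _ (Setoid.quotientKerEquivRange F).symm
  haveI : Finite (Nm ⧸ T.subgroupOf Nm) := by
    change Finite (Quotient (QuotientGroup.leftRel (T.subgroupOf Nm)))
    rw [← hker]; infer_instance
  exact Subgroup.index_ne_zero_of_finite

end Two

end Literature.LinearAlgebra.Matrix

end
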